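import Mathlib
import HarnessLib
import Summits.NavierStokesRegularity.NavierStokesRegularity.Theorems.TaylorModelRungThreeReadoutVCrossing
import Summits.NavierStokesRegularity.NavierStokesRegularity.Theorems.TaylorModelRungThreeReadoutVNodes

/-!
# Line `taylor-model` on crux K1b-DR (stmt-NavierStokesRegularity-23954) — G4-v part 1: the BASE LANDING inequality
# of K1b-DR's landing block under the v3 certificate

The first half of `KBlockLand`: for every stage `j`, the base point `x j 0` lies in the polytope ((R0)) and the
landing read-out of its crossing state obeys `|ℓ_{nx j,l} (land (φ(x j 0)(τ)) v) − ctr| + β ≤ rad − s` for admissible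
tails `v` — read off (R9) at the crossing state, which lies in the level-0 in-step box `Y⁰` (G1-v: the base
trajectory's node at `S−1` is a `NodeStart 0` state, hence in `H⁰_{S−1}`; (R6) via `stAt_mem_Y`) and on the section
(`crossing_factsV`).

* `baseCrossing_mem_Y0` — the base crossing state lies in `Y⁰` and on the section;
* `baseLanding_ofV` — the base landing inequality for all stages and tails.

MODEL-lattice rung TL-M3 only; nothing here is a statement about the Navier–Stokes equations.
-/

noncomputable section

-- the sub-problem namespace repeats the summit name by design (D-0017)
set_option linter.dupNamespace false

namespace Summit.NavierStokesRegularity.NavierStokesRegularity.Theorems.TaylorModelV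

open Set
open Literature.Analysis.FluidPDE.TaoCascade Literature.Analysis.FluidPDE.TaoCascade.TaylorChain
open Summit.NavierStokesRegularity.NavierStokesRegularity.Theorems.TaylorModelReadout

variable {cd : CertData} {bx : StepBoxes} {rd : RadiiData} {ro : ReadoutData} {φ : Flow}

/-- **The base crossing state** `φ(x j 0)(tauSel)` lies in the level-0 in-step box `Y⁰` and on the section.
[folklore] -/
theorem baseCrossing_mem_Y0 (hSN : cd.StageNumerics) (hC : ChainVCore cd bx) (hR : ChainVRadii cd bx rd)
    (hF : IsFlowPackageV cd bx φ) (hRO : ReadoutsV cd bx rd ro) {j : ℕ} (hj : j ≤ cd.N₀) :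
    InBox cd (ro.ylo 0 j) (ro.yhi 0 j) (stAt φ j (cd.x j 0) (tauSel cd φ j (cd.x j 0))) ∧
      cd.σf j (stAt φ j (cd.x j 0) (tauSel cd φ j (cd.x j 0))) = cd.lev j := by
  have hS : 1 ≤ cd.S j := (hC j hj).1
  have hs : cd.S j - 1 < cd.S j := Nat.sub_lt hS Nat.one_pos
  obtain ⟨-, hx0, -⟩ := hRO j hj
  obtain ⟨hq, hqN⟩ := (polyInvariantV hC hR hF).1 j hj _ hx0
  obtain ⟨h1, h2, h3, -, -, -⟩ := crossing_factsV hSN hC hF hRO hj hq hqN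
  refine ⟨?_, h3⟩
  have hTs := ((gridV hC hj).2.1 _ hs).2
  rw [Nat.sub_add_cancel hS] at hTs
  have hn0 : InBox cd (bx.hlo 0 j (cd.S j - 1)) (bx.hhi 0 j (cd.S j - 1)) (stAt φ j (cd.x j 0) (cd.Tn j (cd.S j - 1))) :=
    ((polyInvariantV hC hR hF).2 j hj hx0 _ hs.le).2
  rw [(polyNode_shift hC hF hj hq hs.le).2 _ ⟨h1.le, h2⟩]
  exact stAt_mem_Y hSN hC hF hRO hj 0 (by simpa [hullLevel] using hn0) ⟨by linarith, by rw [hTs] at h2; linarith⟩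

/-- **BASE LANDING (first half of `KBlockLand`)**: the base point is in the polytope and its landing read-out at
the crossing satisfies K1b-DR's inequality with allowance `β` ((R0) + (R9)). [folklore] -/
theorem baseLanding_ofV (hSN : cd.StageNumerics) (hC : ChainVCore cd bx) (hR : ChainVRadii cd bx rd)
    (hF : IsFlowPackageV cd bx φ) (hRO : ReadoutsV cd bx rd ro) {j : ℕ} (hj : j ≤ cd.N₀) :
    InPoly cd j (cd.x j 0) ∧ ∀ v : Fin 4 → ℝ, TailOK cd v → ∀ l,
      |cd.ℓ (cd.nx j) l (cd.land j (stAt φ j (cd.x j 0) (tauSel cd φ j (cd.x j 0))) v) - cd.ctr (cd.nx j) l| +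
        cd.β j l ≤ cd.rad (cd.nx j) l - cd.s (cd.nx j) l := by
  obtain ⟨-, hx0, -, -, -, -, -, -, -, -, -, -, -, -, -, hR9, -⟩ := hRO j hj
  obtain ⟨hY, hσ⟩ := baseCrossing_mem_Y0 hSN hC hR hF hRO hj
  exact ⟨hx0, fun v hv l => hR9 _ hY hσ v hv l⟩

end Summit.NavierStokesRegularity.NavierStokesRegularity.Theorems.TaylorModelV

end
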